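import Literature.AlgebraicGeometry.Morphisms.ProjectiveMorphismComposition
import Literature.AlgebraicGeometry.Morphisms.IsoLocusOfFlatProper
import HarnessLib

/-!
# The Segre PRODUCT EMBEDDING of two embedded `Y`-schemes: closed, over `Y`, projective factors; and the open layer of the Hom-scheme

Topic `Literature/AlgebraicGeometry/Morphisms`; namespace `Literature.AlgebraicGeometry.Morphisms`.  THEOREMS ONLY (no definition, no named fact,
no instance, no notation, no `sorry`).  Cell `hodgecm-mathlib` (D-0151), P6 «MOD programme» (crux hLiu418 = stmt-HodgeConjecture-24832), line-candidate
`F0_P6a_IsomSchemeFiniteType` (A-p14 (g34)), inputs of `stub_ICON` ∕ `stub_ILET`: the line's letter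
`prodEmb Y₁ Y₂ j₁ hj₁ j₂ hj₂ := ((Over.homMk j₁ hj₁ ⊗ₘ Over.homMk j₂ hj₂) ≫ segreOver Y (segreIndexEquivFin n₁ n₂)).left` (a Lines `def`, not importable; this
file states everything on the UNFOLDED term so the line closes by delta) is fed to ★ `Morphisms.exists_homSchemePiece_of_layers_quasiCompact` as its product
embedding `jW`.  HC_CM is proved only modulo the 2 remaining named inputs (hLiu418, h413) until rung 0 closes; generic, count-neutral.

## The mathematics

For closed `Y`-embeddings `j₁ : Y₁ ↪ 𝐏(Fin n₁; Y)`, `j₂ : Y₂ ↪ 𝐏(Fin n₂; Y)` ([Hartshorne1977] II §4 p. 103) the product embedding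
`Y₁ ×_Y Y₂ ↪ 𝐏(Fin n₁; Y) ×_Y 𝐏(Fin n₂; Y) ↪ 𝐏(Fin (n₁ n₂ + n₁ + n₂); Y)` (`j₁ ×_Y j₂` followed by the Segre embedding over `Y`, [Hartshorne1977] II Ex. 4.9,
[StacksProject] Tag 01WD; ★ `segreOver`) is a CLOSED IMMERSION over `Y` (§1–§2: `j₁ ×_Y j₂ = pullback.map …` of two closed immersions, Mathlib
`MorphismProperty.pullbackMap`; ★ instance `isClosedImmersion_segreOver_left`; the structure-map identity by ★ `segreOver_left_fst`).  The factors are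
projective in Hartshorne's sense (§3, ★ `Morphisms.IsProjective` by definition) and `1 ≤ #Fin (n₁ n₂ + n₁ + n₂)` as soon as `1 ≤ n₁` (§3).  §4 records
the OPEN LAYER of the Hom-scheme piece in the shape ★ `exists_homSchemePiece_of_layers_quasiCompact` consumes (its `hB3`; the 3-line closer over ★
`Morphisms/IsoLocusOfFlatProper`, [GortzWedhorn2020] Prop. 14.28 — so far only `private` in ★ `HomSchemeOfProjective`).

## References
* [Hartshorne1977] R. Hartshorne, *Algebraic Geometry* (1977), II §4 (p. 103), II Ex. 4.9 (Segre embedding; products of projective morphisms).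
* [StacksProject] The Stacks Project, Tag 01WD (Lemma 27.13.6).
* [GortzWedhorn2020] U. Görtz, T. Wedhorn, *Algebraic Geometry I*, 2nd ed. (2020), Proposition 14.28 (p. 438).
* [MumfordFogartyKirwan1994] D. Mumford, J. Fogarty, F. Kirwan, *Geometric Invariant Theory*, 3rd ed. (1994), Ch. 0 §5 (c) (p. 23).
-/

set_option autoImplicit false

noncomputable section

-- Mathlib's `Over`/pull-back API is stated across semireducible wrappers.
set_option backward.isDefEq.respectTransparency false

universe u  -- §1 and §4 are universe-polymorphic; §2–§3 live in universe `0` (`Fin n : Type`, as the Hom-scheme currency)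

open CategoryTheory CategoryTheory.Limits AlgebraicGeometry MonoidalCategory

namespace Literature.AlgebraicGeometry.Morphisms

/-! ### §1 `f ⊗ₘ g` in `Over Y` is a closed immersion when `f` and `g` are -/

/-- The tensor product (fibre product over `Y`) of two closed immersions of `Y`-schemes is a closed immersion: `(f ⊗ₘ g).left = pullback.map …`
(Mathlib `Over.tensorHom_left`), and closed immersions are stable under base change and composition (Mathlib `MorphismProperty.pullbackMap`).
[cite: Hartshorne1977, II Ex. 4.9] [cite: StacksProject, Tag 01WD] -/
theorem isClosedImmersion_tensorHom_left {Y : Scheme.{u}} {R S T U : Over Y} (f : R ⟶ S) (g : T ⟶ U)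
    [hf : IsClosedImmersion f.left] [hg : IsClosedImmersion g.left] : IsClosedImmersion (f ⊗ₘ g).left := by
  rw [Over.tensorHom_left]
  exact MorphismProperty.pullbackMap (P := @IsClosedImmersion) hf hg (Over.w f).symm (Over.w g).symm

/-! ### §2 The Segre product embedding of two embedded `Y`-schemes -/

section Prod

variable {Y : Scheme.{0}} (Y₁ Y₂ : Over Y) {n₁ n₂ : ℕ}
  (j₁ : Y₁.left ⟶ projectiveSpace (Fin n₁) Y) (hj₁ : j₁ ≫ projectiveSpaceFst (Fin n₁) Y = Y₁.hom)
  (j₂ : Y₂.left ⟶ projectiveSpace (Fin n₂) Y) (hj₂ : j₂ ≫ projectiveSpaceFst (Fin n₂) Y = Y₂.hom)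

/-- **The product embedding `Y₁ ×_Y Y₂ ↪ 𝐏(Fin (n₁ n₂ + n₁ + n₂); Y)` is a closed immersion** (`j₁ ×_Y j₂` closed by §1, then the Segre embedding
over `Y`, ★ `isClosedImmersion_segreOver_left`). [cite: Hartshorne1977, II Ex. 4.9] [cite: StacksProject, Tag 01WD] -/
theorem isClosedImmersion_prodEmb [IsClosedImmersion j₁] [IsClosedImmersion j₂] :
    IsClosedImmersion (((Over.homMk j₁ hj₁ : Y₁ ⟶ Over.mk (projectiveSpaceFst (Fin n₁) Y)) ⊗ₘ
        (Over.homMk j₂ hj₂ : Y₂ ⟶ Over.mk (projectiveSpaceFst (Fin n₂) Y))) ≫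
      segreOver Y (segreIndexEquivFin n₁ n₂)).left := by
  haveI : IsClosedImmersion (Over.homMk j₁ hj₁ : Y₁ ⟶ Over.mk (projectiveSpaceFst (Fin n₁) Y)).left := by
    change IsClosedImmersion j₁; infer_instance
  haveI : IsClosedImmersion (Over.homMk j₂ hj₂ : Y₂ ⟶ Over.mk (projectiveSpaceFst (Fin n₂) Y)).left := by
    change IsClosedImmersion j₂; infer_instance
  haveI := isClosedImmersion_tensorHom_left (Over.homMk j₁ hj₁ : Y₁ ⟶ Over.mk (projectiveSpaceFst (Fin n₁) Y))
    (Over.homMk j₂ hj₂ : Y₂ ⟶ Over.mk (projectiveSpaceFst (Fin n₂) Y))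
  rw [Over.comp_left]
  infer_instance

/-- **The product embedding lies over `Y` through the FIRST factor**: composed with `𝐏(τ; Y) → Y` it is `pr₁ ≫ (Y₁ → Y)` — the identity ★
`exists_homSchemePiece_of_layers_quasiCompact` asks of its `jW`. (★ `segreOver_left_fst`, Mathlib `Over.tensorHom_left_fst`.)
[cite: StacksProject, Tag 01WD] [cite: MumfordFogartyKirwan1994, Ch. 0 §5 (c) (p. 23)] -/
theorem prodEmb_comp_projectiveSpaceFst :
    (((Over.homMk j₁ hj₁ : Y₁ ⟶ Over.mk (projectiveSpaceFst (Fin n₁) Y)) ⊗ₘ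
        (Over.homMk j₂ hj₂ : Y₂ ⟶ Over.mk (projectiveSpaceFst (Fin n₂) Y))) ≫
      segreOver Y (segreIndexEquivFin n₁ n₂)).left ≫ projectiveSpaceFst (Fin (n₁ * n₂ + n₁ + n₂)) Y =
      pullback.fst Y₁.hom Y₂.hom ≫ Y₁.hom := by
  rw [Over.comp_left, Category.assoc, segreOver_left_fst]
  change ((Over.homMk j₁ hj₁ : Y₁ ⟶ Over.mk (projectiveSpaceFst (Fin n₁) Y)) ⊗ₘ
      (Over.homMk j₂ hj₂ : Y₂ ⟶ Over.mk (projectiveSpaceFst (Fin n₂) Y))).left ≫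
      pullback.fst (projectiveSpaceFst (Fin n₁) Y) (projectiveSpaceFst (Fin n₂) Y) ≫ projectiveSpaceFst (Fin n₁) Y = _
  rw [Over.tensorHom_left_fst_assoc]
  change pullback.fst Y₁.hom Y₂.hom ≫ j₁ ≫ projectiveSpaceFst (Fin n₁) Y = _
  rw [hj₁]

end Prod

/-! ### §3 Projectivity of the factors and positivity of the ambient dimension -/

/-- A `Y`-scheme closed-embedded into `𝐏(Fin n; Y)` over `Y` is projective over `Y` in Hartshorne's sense (★ `Morphisms.IsProjective`, by definition).
[cite: Hartshorne1977, II §4 (p. 103)] -/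
theorem isProjective_of_isClosedImmersion_projectiveSpace_fin {Y X : Scheme.{0}} {f : X ⟶ Y} {n : ℕ}
    (j : X ⟶ projectiveSpace (Fin n) Y) [IsClosedImmersion j] (hj : j ≫ projectiveSpaceFst (Fin n) Y = f) : IsProjective f :=
  ⟨Fin n, inferInstance, j, inferInstance, hj⟩

/-- `1 ≤ #Fin (n₁ n₂ + n₁ + n₂)` as soon as `1 ≤ n₁` (the positivity ★ `exists_homSchemePiece_of_layers_quasiCompact` asks of the ambient projective
space). [cite: Hartshorne1977, II Ex. 4.9] -/
theorem one_le_natCard_fin_segre {n₁ n₂ : ℕ} (hn : 1 ≤ n₁) : 1 ≤ Nat.card (Fin (n₁ * n₂ + n₁ + n₂)) := by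
  rw [Nat.card_fin]
  omega

/-! ### §4 The open layer of the Hom-scheme piece (public form of the 3-line closer over ★ `IsoLocusOfFlatProper`) -/

/-- **(B3) The open layer «the family projects isomorphically onto `Y`»** in the shape ★ `exists_homSchemePiece_of_layers_quasiCompact` consumes as
`hB3`: for `f : Γ → V` proper flat, `q′ : Y′ → V` separated universally closed with `Y′` locally Noetherian and `g : Γ → Y′` over `V`, an OPEN
`U ⊆ V` such that `b : T → V` lands in `U` iff the base change `g_T` is an isomorphism (★ `exists_opens_isIso_morphismRestrict_forall_mem_iff`,
★ `isIso_pullbackMap_iff_range_subset`). [cite: GortzWedhorn2020, Proposition 14.28 (p. 438)] -/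
theorem openLayer_of_isoLocus_hB3 : ∀ ⦃V Γ Y' : Scheme.{u}⦄ (f : Γ ⟶ V) (q' : Y' ⟶ V) (g : Γ ⟶ Y') (hg : g ≫ q' = f)
    [IsProper f] [Flat f] [IsSeparated q'] [UniversallyClosed q'] [IsLocallyNoetherian Y'],
    ∃ U : V.Opens, ∀ ⦃T : Scheme.{u}⦄ (b : T ⟶ V),
      IsIso (pullback.map f b q' b g (𝟙 T) (𝟙 V) (by rw [Category.comp_id, hg]) (by rw [Category.comp_id, Category.id_comp])) ↔
        Set.range b.base ⊆ (U : Set V) := by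
  intro V Γ Y' f q' g hg _ _ _ _ _
  obtain ⟨U, hU, hUiff⟩ := exists_opens_isIso_morphismRestrict_forall_mem_iff f q' g hg
  exact ⟨U, fun T b => isIso_pullbackMap_iff_range_subset f q' g hg U hU hUiff b⟩

end Literature.AlgebraicGeometry.Morphisms

end
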